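import Literature.Computability.ImplicitComplexity.STALeftmost
import Literature.Computability.ImplicitComplexity.STAWeighted
import HarnessLib

/-!
# Prefix token codes of λ-terms and the leftmost-outermost β-step on codes

Support file for the `PTIME` soundness half of `STACapturesP` (GMR08 Thm. 3.5: "every
β-reduction step can be carried out on a Turing machine in a number of steps polynomial in the
size of the term"). A Turing machine sees a term as a string; we fix the string-level data
structure and algorithms here, as plain LIST programs (left folds with small states), and prove
them correct against the term-level step `Term.loStep` of `STALeftmost.lean`; their
realisation as polynomial-time string functions is the sequel.

* `Tok`, `Term.pre` — prefix (Polish) code of a term: `var i ↦ [V i]`, `λM ↦ L :: pre M`,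
  `M N ↦ A :: pre M ++ pre N` (sums `S`, inert); `length_pre : |pre M| = |M|`; prefix codes are
  uniquely decodable (`pre_append_inj`, `pre_injective`);
* `spanTerm` — split a token list into its first complete term and the rest, by the arity count
  (`spanTerm (pre P ++ r) = (pre P, r)`);
* `shiftToks D`, `substToks` — de Bruijn shifting and the β-substitution `P[N/x₀]` on codes, by
  one left-to-right pass keeping the stack of binder depths of the pending subterms
  (`shiftToks_pre`, `substToks_pre : substToks (pre P) (pre N) = pre (P.subst0 N)`);
* `splitRedex` — locate the leftmost-outermost redex: the first adjacent pair `A, L` in prefix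
  order, splitting the code around it; `loStepToks` — the whole step;
  **`loStepToks_pre : loStepToks (pre M) = pre (M.loStep)`**.

## References

* [GaboardiMarionRonchidellarocca2008] GMR08, Thm. 3.5.
* N. G. de Bruijn, Lambda calculus notation with nameless dummies, Indag. Math. 34 (1972)
  (shifting and substitution on nameless terms). Folklore data-structure facts, fully proved.
-/

namespace Literature.Computability.ImplicitComplexity

namespace STA

/-! ### Tokens and prefix codes -/

/-- Tokens of the prefix code of a term. [folklore] -/
inductive Tok : Type
  | V (i : ℕ)
  | L
  | A
  | S
  deriving DecidableEq, Inhabited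

/-- Arity of a token (number of subterms following it). [folklore] -/
def Tok.arity : Tok → ℕ
  | .V _ => 0
  | .L => 1
  | .A => 2
  | .S => 2

/-- Prefix (Polish) code of a term. [folklore] -/
def Term.pre : Term → List Tok
  | .var i => [.V i]
  | .app M N => .A :: (Term.pre M ++ Term.pre N)
  | .lam M => .L :: Term.pre M
  | .sum M N => .S :: (Term.pre M ++ Term.pre N)

/-- The code has one token per symbol. [folklore] -/
theorem Term.length_pre (M : Term) : M.pre.length = M.size := by
  induction M with
  | var i => rfl
  | app M N ihM ihN => simp [Term.pre, Term.size, ihM, ihN]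
  | lam M ih => simp [Term.pre, Term.size, ih]
  | sum M N ihM ihN => simp [Term.pre, Term.size, ihM, ihN]

/-- The code of `0 ≐ λλ.x₁`. [folklore] -/
theorem pre_zero : STA.zero.pre = [.L, .L, .V 1] := rfl

/-! ### Splitting off the first complete term -/

/-- One step of the span scan: state `(need, taken, rest)`. [folklore] -/
def spanStep (st : ℕ × List Tok × List Tok) (t : Tok) : ℕ × List Tok × List Tok :=
  if st.1 = 0 then (0, st.2.1, st.2.2 ++ [t]) else (st.1 - 1 + t.arity, st.2.1 ++ [t], st.2.2)

/-- Split a token list into its first complete term and the remainder. [folklore] -/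
def spanTerm (ts : List Tok) : List Tok × List Tok :=
  ((ts.foldl spanStep (1, [], [])).2.1, (ts.foldl spanStep (1, [], [])).2.2)

/-- The span scan over a complete code lowers the need by one. [folklore] -/
theorem foldl_spanStep_pre (P : Term) (k : ℕ) (acc : List Tok) :
    P.pre.foldl spanStep (k + 1, acc, []) = (k, acc ++ P.pre, []) := by
  induction P generalizing k acc with
  | var i => simp [Term.pre, spanStep, Tok.arity]
  | app M N ihM ihN =>
    have h1 : spanStep (k + 1, acc, []) Tok.A = (k + 2, acc ++ [Tok.A], []) := by
      simp [spanStep, Tok.arity]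
    have he : acc ++ Term.pre (.app M N) = acc ++ [Tok.A] ++ M.pre ++ N.pre := by simp [Term.pre]
    rw [he, show Term.pre (.app M N) = Tok.A :: (M.pre ++ N.pre) from rfl, List.foldl_cons,
      List.foldl_append, h1, show k + 2 = (k + 1) + 1 from rfl, ihM, ihN]
  | lam M ih =>
    have h1 : spanStep (k + 1, acc, []) Tok.L = (k + 1, acc ++ [Tok.L], []) := by
      simp [spanStep, Tok.arity]
    have he : acc ++ Term.pre (.lam M) = acc ++ [Tok.L] ++ M.pre := by simp [Term.pre]
    rw [he, show Term.pre (.lam M) = Tok.L :: M.pre from rfl, List.foldl_cons, h1, ih]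
  | sum M N ihM ihN =>
    have h1 : spanStep (k + 1, acc, []) Tok.S = (k + 2, acc ++ [Tok.S], []) := by
      simp [spanStep, Tok.arity]
    have he : acc ++ Term.pre (.sum M N) = acc ++ [Tok.S] ++ M.pre ++ N.pre := by simp [Term.pre]
    rw [he, show Term.pre (.sum M N) = Tok.S :: (M.pre ++ N.pre) from rfl, List.foldl_cons,
      List.foldl_append, h1, show k + 2 = (k + 1) + 1 from rfl, ihM, ihN]

/-- After the first term the scan copies to the remainder. [folklore] -/
theorem foldl_spanStep_zero (xs a r : List Tok) : xs.foldl spanStep (0, a, r) = (0, a, r ++ xs) := by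
  induction xs generalizing r with
  | nil => simp
  | cons x xs ih => simp [spanStep, ih]

/-- **`spanTerm` splits off a complete code.** [folklore] -/
theorem spanTerm_pre_append (P : Term) (r : List Tok) : spanTerm (P.pre ++ r) = (P.pre, r) := by
  unfold spanTerm
  rw [List.foldl_append, foldl_spanStep_pre P 0 [], foldl_spanStep_zero]
  simp

/-- Prefix codes are uniquely decodable. [folklore] -/
theorem pre_append_inj {M M' : Term} {r r' : List Tok} (h : M.pre ++ r = M'.pre ++ r') :
    M = M' ∧ r = r' := by
  induction M generalizing M' r r' with
  | var i =>
    cases M' with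
    | var j => simp [Term.pre] at h; exact ⟨by rw [h.1], h.2⟩
    | app _ _ => simp [Term.pre] at h
    | lam _ => simp [Term.pre] at h
    | sum _ _ => simp [Term.pre] at h
  | app M N ihM ihN =>
    cases M' with
    | app M' N' =>
      simp only [Term.pre, List.cons_append, List.append_assoc, List.cons.injEq, true_and] at h
      obtain ⟨rfl, h2⟩ := ihM h
      obtain ⟨rfl, rfl⟩ := ihN h2
      exact ⟨rfl, rfl⟩
    | var _ => simp [Term.pre] at h
    | lam _ => simp [Term.pre] at h
    | sum _ _ => simp [Term.pre] at h
  | lam M ih =>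
    cases M' with
    | lam M' =>
      simp only [Term.pre, List.cons_append, List.cons.injEq, true_and] at h
      obtain ⟨rfl, rfl⟩ := ih h
      exact ⟨rfl, rfl⟩
    | var _ => simp [Term.pre] at h
    | app _ _ => simp [Term.pre] at h
    | sum _ _ => simp [Term.pre] at h
  | sum M N ihM ihN =>
    cases M' with
    | sum M' N' =>
      simp only [Term.pre, List.cons_append, List.append_assoc, List.cons.injEq, true_and] at h
      obtain ⟨rfl, h2⟩ := ihM h
      obtain ⟨rfl, rfl⟩ := ihN h2
      exact ⟨rfl, rfl⟩
    | var _ => simp [Term.pre] at h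
    | app _ _ => simp [Term.pre] at h
    | lam _ => simp [Term.pre] at h

/-- `pre` is injective. [folklore] -/
theorem pre_injective : Function.Injective Term.pre := fun M M' h =>
  (pre_append_inj (r := []) (r' := []) (by rw [h])).1

/-! ### Shifting on codes -/

/-- Iterated lifting of a renaming. [folklore] -/
theorem liftRen_iterate_apply (ρ : ℕ → ℕ) (d k : ℕ) :
    (liftRen^[d] ρ) k = if k < d then k else ρ (k - d) + d := by
  induction d generalizing k with
  | zero => simp
  | succ d ih =>
    rw [Function.iterate_succ_apply']
    cases k with
    | zero => simp [liftRen]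
    | succ k =>
      rw [liftRen_succ, ih]
      by_cases h : k < d
      · simp [h, show k + 1 < d + 1 by omega]
      · simp [h, show ¬(k + 1 < d + 1) by omega]
        omega

/-- One step of the shift pass: state `(depth stack, output)`. [folklore] -/
def shiftStep (D : ℕ) (st : List ℕ × List Tok) (t : Tok) : List ℕ × List Tok :=
  let d := st.1.headD 0
  let stk := st.1.tail
  match t with
  | .V k => (stk, st.2 ++ [.V (if d ≤ k then k + D else k)])
  | .L => ((d + 1) :: stk, st.2 ++ [.L])
  | .A => (d :: d :: stk, st.2 ++ [.A])
  | .S => (d :: d :: stk, st.2 ++ [.S])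

/-- Shift the free variables of a code by `D`. [folklore] -/
def shiftToks (D : ℕ) (ts : List Tok) : List Tok := (ts.foldl (shiftStep D) ([0], [])).2

/-- The shift pass on a complete code at depth `d`. [folklore] -/
theorem foldl_shiftStep_pre (D : ℕ) (N : Term) (d : ℕ) (stk : List ℕ) (out : List Tok) :
    N.pre.foldl (shiftStep D) (d :: stk, out) =
      (stk, out ++ (N.rename (liftRen^[d] (fun i => i + D))).pre) := by
  induction N generalizing d stk out with
  | var k =>
    simp only [Term.pre, List.foldl_cons, List.foldl_nil, shiftStep, List.headD_cons, List.tail_cons,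
      Term.rename, liftRen_iterate_apply]
    by_cases h : d ≤ k
    · simp [h, show ¬(k < d) by omega]
      omega
    · simp [h, show k < d by omega]
  | app M N ihM ihN =>
    simp only [Term.pre, List.foldl_cons, List.foldl_append, shiftStep, List.headD_cons,
      List.tail_cons, Term.rename]
    rw [ihM, ihN]
    simp
  | lam M ih =>
    simp only [Term.pre, List.foldl_cons, shiftStep, List.headD_cons, List.tail_cons, Term.rename]
    rw [ih]
    simp [Function.iterate_succ_apply']
  | sum M N ihM ihN =>
    simp only [Term.pre, List.foldl_cons, List.foldl_append, shiftStep, List.headD_cons,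
      List.tail_cons, Term.rename]
    rw [ihM, ihN]
    simp

/-- **Shifting on codes is shifting.** [folklore] -/
theorem shiftToks_pre (D : ℕ) (N : Term) : shiftToks D N.pre = (N.rename fun i => i + D).pre := by
  unfold shiftToks
  rw [foldl_shiftStep_pre D N 0 [] []]
  simp

/-! ### The β-substitution on codes -/

/-- Iterated lifting of a substitution. [folklore] -/
theorem up_iterate_apply (σ : ℕ → Term) (d k : ℕ) :
    (Term.up^[d] σ) k = if k < d then .var k else (σ (k - d)).rename (fun i => i + d) := by
  induction d generalizing k with
  | zero => simp [Term.rename_id']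
  | succ d ih =>
    rw [Function.iterate_succ_apply']
    cases k with
    | zero => simp [Term.up]
    | succ k =>
      rw [Term.up_succ, ih]
      by_cases h : k < d
      · simp [h, show k + 1 < d + 1 by omega, Term.rename]
      · simp only [h, if_false, show ¬(k + 1 < d + 1) by omega, Term.rename_rename]
        rw [Nat.add_sub_add_right]
        exact Term.rename_congr (fun i => by show Nat.succ (i + d) = i + (d + 1); omega) _

/-- One step of the substitution pass (argument code `arg`): state `(depth stack, output)`.
[folklore] -/
def substStep (arg : List Tok) (st : List ℕ × List Tok) (t : Tok) : List ℕ × List Tok :=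
  let d := st.1.headD 0
  let stk := st.1.tail
  match t with
  | .V k => (stk, st.2 ++ (if k < d then [.V k] else if k = d then shiftToks d arg else [.V (k - 1)]))
  | .L => ((d + 1) :: stk, st.2 ++ [.L])
  | .A => (d :: d :: stk, st.2 ++ [.A])
  | .S => (d :: d :: stk, st.2 ++ [.S])

/-- The β-substitution `P[N/x₀]` on codes. [folklore] -/
def substToks (body arg : List Tok) : List Tok := (body.foldl (substStep arg) ([0], [])).2

/-- The substitution pass on a complete code at depth `d`. [folklore] -/
theorem foldl_substStep_pre (N P : Term) (d : ℕ) (stk : List ℕ) (out : List Tok) :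
    P.pre.foldl (substStep N.pre) (d :: stk, out) =
      (stk, out ++ (P.substp (Term.up^[d] (Term.consSub N))).pre) := by
  induction P generalizing d stk out with
  | var k =>
    simp only [Term.pre, List.foldl_cons, List.foldl_nil, substStep, List.headD_cons, List.tail_cons,
      Term.substp, up_iterate_apply]
    by_cases h1 : k < d
    · simp [h1, Term.pre]
    · by_cases h2 : k = d
      · subst h2
        simp [shiftToks_pre]
      · have h3 : k - d = (k - d - 1) + 1 := by omega
        simp only [h1, h2, if_false]
        rw [h3, Term.consSub_succ]
        simp [Term.rename, Term.pre]
        omega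
  | app M₁ M₂ ih₁ ih₂ =>
    simp only [Term.pre, List.foldl_cons, List.foldl_append, substStep, List.headD_cons,
      List.tail_cons, Term.substp]
    rw [ih₁, ih₂]
    simp
  | lam M ih =>
    simp only [Term.pre, List.foldl_cons, substStep, List.headD_cons, List.tail_cons, Term.substp]
    rw [ih]
    simp [Function.iterate_succ_apply']
  | sum M₁ M₂ ih₁ ih₂ =>
    simp only [Term.pre, List.foldl_cons, List.foldl_append, substStep, List.headD_cons,
      List.tail_cons, Term.substp]
    rw [ih₁, ih₂]
    simp

/-- **Substitution on codes is the β-substitution.** [folklore] -/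
theorem substToks_pre (P N : Term) : substToks P.pre N.pre = (P.subst0 N).pre := by
  unfold substToks
  rw [foldl_substStep_pre N P 0 [] [], Term.subst0_eq_substp]
  simp

/-! ### Locating the leftmost-outermost redex -/

/-- One step of the redex search: state `(before, pendingA, found, after)`; an `A` is kept
pending for one token so that the pair `A, L` of a redex can be dropped. [folklore] -/
def splitStep (st : List Tok × Bool × Bool × List Tok) (t : Tok) : List Tok × Bool × Bool × List Tok :=
  let before := st.1
  let pend := st.2.1
  let found := st.2.2.1
  let after := st.2.2.2
  if found then (before, pend, true, after ++ [t])
  else if pend then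
    (if t = .L then (before, false, true, after)
     else if t = .A then (before ++ [.A], true, false, after)
     else (before ++ [.A, t], false, false, after))
  else if t = .A then (before, true, false, after) else (before ++ [t], false, false, after)

/-- The redex search: `(found, before, after)` with the code equal to `before ++ [A, L] ++ after`
when found. [folklore] -/
def splitRedex (ts : List Tok) : Bool × List Tok × List Tok :=
  let st := ts.foldl splitStep ([], false, false, [])
  (st.2.2.1, st.1 ++ (if st.2.1 && !st.2.2.1 then [.A] else []), st.2.2.2)

/-- **The leftmost-outermost step on codes.** [folklore] -/
def loStepToks (ts : List Tok) : List Tok :=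
  let sp := splitRedex ts
  if sp.1 then
    let b := spanTerm sp.2.2
    let a := spanTerm b.2
    sp.2.1 ++ substToks b.1 a.1 ++ a.2
  else ts

/-- Once found, the search copies to `after`. [folklore] -/
theorem foldl_splitStep_found (xs before after : List Tok) (pend : Bool) :
    xs.foldl splitStep (before, pend, true, after) = (before, pend, true, after ++ xs) := by
  induction xs generalizing after with
  | nil => simp
  | cons x xs ih => simp [splitStep, ih]

/-- A term is an abstraction. [folklore] -/
def Term.isLam : Term → Bool
  | .lam _ => true
  | _ => false

/-- **No redex: the search passes through.** [folklore] -/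
theorem foldl_splitStep_noRedex : ∀ (M : Term), M.hasRedex = false →
    ∀ (before : List Tok) (pend : Bool), (pend = true → M.isLam = false) →
    M.pre.foldl splitStep (before, pend, false, []) =
      (before ++ (if pend then [.A] else []) ++ M.pre, false, false, [])
  | .var i, _, before, pend, _ => by cases pend <;> simp [Term.pre, splitStep]
  | .lam M, h, before, pend, hp => by
    cases pend with
    | true => simp [Term.isLam] at hp
    | false =>
      simp only [Term.hasRedex] at h
      simp only [Term.pre, List.foldl_cons, splitStep, Bool.false_eq_true, if_false, reduceCtorEq]
      rw [foldl_splitStep_noRedex M h _ false (fun h => by cases h)]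
      simp
  | .app M N, h, before, pend, _ => by
    -- `M` is not an abstraction and has no redex; `N` has no redex
    have hM : M.hasRedex = false ∧ M.isLam = false ∧ N.hasRedex = false := by
      cases M with
      | lam _ => simp [Term.hasRedex] at h
      | var _ => simp [Term.hasRedex] at h; exact ⟨rfl, rfl, h⟩
      | app _ _ => simp [Term.hasRedex] at h; exact ⟨by simpa [Term.hasRedex] using h.1, rfl, h.2⟩
      | sum _ _ => simp [Term.hasRedex] at h; exact ⟨by simpa [Term.hasRedex] using h.1, rfl, h.2⟩
    simp only [Term.pre, List.foldl_cons, List.foldl_append]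
    have h1 : splitStep (before, pend, false, []) Tok.A =
        (before ++ (if pend then [Tok.A] else []), true, false, []) := by
      cases pend <;> simp [splitStep]
    rw [h1, foldl_splitStep_noRedex M hM.1 _ true (fun _ => hM.2.1),
      foldl_splitStep_noRedex N hM.2.2 _ false (fun h => by cases h)]
    simp
  | .sum M N, h, before, pend, _ => by
    simp only [Term.hasRedex, Bool.or_eq_false_iff] at h
    simp only [Term.pre, List.foldl_cons, List.foldl_append]
    have h1 : splitStep (before, pend, false, []) Tok.S =
        (before ++ (if pend then [Tok.A] else []) ++ [Tok.S], false, false, []) := by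
      cases pend <;> simp [splitStep]
    rw [h1, foldl_splitStep_noRedex M h.1 _ false (fun h => by cases h),
      foldl_splitStep_noRedex N h.2 _ false (fun h => by cases h)]
    simp

/-- The leftmost-outermost redex of a term, as a decomposition of its code:
`(before, body, argument, after)`. [folklore] -/
def Term.redexDecomp : Term → List Tok × Term × Term × List Tok
  | .var i => ([], .var i, .var i, [])
  | .lam M => let r := Term.redexDecomp M; (.L :: r.1, r.2.1, r.2.2.1, r.2.2.2)
  | .app (.lam P) N => ([], P, N, [])
  | .app (.var i) N => let r := Term.redexDecomp N; (.A :: .V i :: r.1, r.2.1, r.2.2.1, r.2.2.2)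
  | .app (.app M₁ M₂) N =>
      if Term.hasRedex (.app M₁ M₂) then
        let r := Term.redexDecomp (.app M₁ M₂); (.A :: r.1, r.2.1, r.2.2.1, r.2.2.2 ++ N.pre)
      else let r := Term.redexDecomp N; (.A :: (Term.pre (.app M₁ M₂) ++ r.1), r.2.1, r.2.2.1, r.2.2.2)
  | .app (.sum M₁ M₂) N =>
      if Term.hasRedex (.sum M₁ M₂) then
        let r := Term.redexDecomp (.sum M₁ M₂); (.A :: r.1, r.2.1, r.2.2.1, r.2.2.2 ++ N.pre)
      else let r := Term.redexDecomp N; (.A :: (Term.pre (.sum M₁ M₂) ++ r.1), r.2.1, r.2.2.1, r.2.2.2)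
  | .sum M N =>
      if Term.hasRedex M then let r := Term.redexDecomp M; (.S :: r.1, r.2.1, r.2.2.1, r.2.2.2 ++ N.pre)
      else let r := Term.redexDecomp N; (.S :: (M.pre ++ r.1), r.2.1, r.2.2.1, r.2.2.2)

/-- **The decomposition is correct**: the code splits around the redex, and the step replaces the
redex by its contractum. [folklore] -/
theorem Term.redexDecomp_spec : ∀ (M : Term), M.hasRedex = true →
    M.pre = (M.redexDecomp).1 ++ [.A, .L] ++ (M.redexDecomp).2.1.pre ++ (M.redexDecomp).2.2.1.pre ++
      (M.redexDecomp).2.2.2 ∧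
    M.loStep.pre = (M.redexDecomp).1 ++ ((M.redexDecomp).2.1.subst0 (M.redexDecomp).2.2.1).pre ++
      (M.redexDecomp).2.2.2
  | .var i, h => by simp [Term.hasRedex] at h
  | .lam M, h => by
    simp only [Term.hasRedex] at h
    obtain ⟨h1, h2⟩ := Term.redexDecomp_spec M h
    refine ⟨?_, ?_⟩
    · simp only [Term.pre, Term.redexDecomp]; rw [h1]; simp
    · simp only [Term.loStep, Term.pre, Term.redexDecomp]; rw [h2]; simp
  | .app (.lam P) N, _ => by simp [Term.pre, Term.redexDecomp, Term.loStep]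
  | .app (.var i) N, h => by
    simp only [Term.hasRedex] at h
    obtain ⟨h1, h2⟩ := Term.redexDecomp_spec N h
    refine ⟨?_, ?_⟩
    · simp only [Term.pre, Term.redexDecomp]
      rw [h1]; simp
    · simp only [Term.loStep, Term.pre, Term.redexDecomp]
      rw [h2]; simp
  | .app (.app M₁ M₂) N, h => by
    by_cases hM : Term.hasRedex (.app M₁ M₂) = true
    · obtain ⟨h1, h2⟩ := Term.redexDecomp_spec (.app M₁ M₂) hM
      refine ⟨?_, ?_⟩
      · rw [Term.redexDecomp, if_pos hM]
        simp only [Term.pre] at h1 ⊢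
        rw [h1]; simp
      · rw [Term.redexDecomp, if_pos hM, Term.loStep, if_pos hM]
        simp only [Term.pre]
        rw [h2]; simp
    · have hN : N.hasRedex = true := by
        simp only [Term.hasRedex, Bool.or_eq_true] at h
        rcases h with h | h
        · exact absurd (by simpa [Term.hasRedex] using h) hM
        · exact h
      obtain ⟨h1, h2⟩ := Term.redexDecomp_spec N hN
      refine ⟨?_, ?_⟩
      · rw [Term.redexDecomp, if_neg hM]
        simp only [Term.pre]
        rw [h1]; simp
      · rw [Term.redexDecomp, if_neg hM, Term.loStep, if_neg hM]
        simp only [Term.pre]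
        rw [h2]; simp
  | .app (.sum M₁ M₂) N, h => by
    by_cases hM : Term.hasRedex (.sum M₁ M₂) = true
    · obtain ⟨h1, h2⟩ := Term.redexDecomp_spec (.sum M₁ M₂) hM
      refine ⟨?_, ?_⟩
      · rw [Term.redexDecomp, if_pos hM]
        simp only [Term.pre] at h1 ⊢
        rw [h1]; simp
      · rw [Term.redexDecomp, if_pos hM, Term.loStep, if_pos hM]
        simp only [Term.pre]
        rw [h2]; simp
    · have hN : N.hasRedex = true := by
        simp only [Term.hasRedex, Bool.or_eq_true] at h
        rcases h with h | h
        · exact absurd (by simpa [Term.hasRedex] using h) hM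
        · exact h
      obtain ⟨h1, h2⟩ := Term.redexDecomp_spec N hN
      refine ⟨?_, ?_⟩
      · rw [Term.redexDecomp, if_neg hM]
        simp only [Term.pre]
        rw [h1]; simp
      · rw [Term.redexDecomp, if_neg hM, Term.loStep, if_neg hM]
        simp only [Term.pre]
        rw [h2]; simp
  | .sum M N, h => by
    by_cases hM : M.hasRedex = true
    · obtain ⟨h1, h2⟩ := Term.redexDecomp_spec M hM
      refine ⟨?_, ?_⟩
      · rw [Term.redexDecomp, if_pos hM]
        simp only [Term.pre]
        rw [h1]; simp
      · rw [Term.redexDecomp, if_pos hM, Term.loStep, if_pos hM]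
        simp only [Term.pre]
        rw [h2]; simp
    · have hN : N.hasRedex = true := by
        simp only [Term.hasRedex, Bool.or_eq_true] at h
        rcases h with h | h
        · exact absurd h hM
        · exact h
      obtain ⟨h1, h2⟩ := Term.redexDecomp_spec N hN
      refine ⟨?_, ?_⟩
      · rw [Term.redexDecomp, if_neg hM]
        simp only [Term.pre]
        rw [h1]; simp
      · rw [Term.redexDecomp, if_neg hM, Term.loStep, if_neg hM]
        simp only [Term.pre]
        rw [h2]; simp

/-- **With a redex: the search stops at the leftmost-outermost one.** [folklore] -/
theorem foldl_splitStep_redex : ∀ (M : Term), M.hasRedex = true →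
    ∀ (before : List Tok) (pend : Bool), (pend = true → M.isLam = false) →
    M.pre.foldl splitStep (before, pend, false, []) =
      (before ++ (if pend then [.A] else []) ++ (M.redexDecomp).1, false, true,
        (M.redexDecomp).2.1.pre ++ (M.redexDecomp).2.2.1.pre ++ (M.redexDecomp).2.2.2)
  | .var i, h, _, _, _ => by simp [Term.hasRedex] at h
  | .lam M, h, before, pend, hp => by
    cases pend with
    | true => simp [Term.isLam] at hp
    | false =>
      simp only [Term.hasRedex] at h
      simp only [Term.pre, List.foldl_cons, splitStep, Bool.false_eq_true, if_false, reduceCtorEq]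
      rw [foldl_splitStep_redex M h _ false (fun h => by cases h)]
      simp [Term.redexDecomp]
  | .app (.lam P) N, _, before, pend, _ => by
    simp only [Term.pre, List.cons_append, List.foldl_cons, List.foldl_append]
    have h1 : splitStep (before, pend, false, []) Tok.A =
        (before ++ (if pend then [Tok.A] else []), true, false, []) := by
      cases pend <;> simp [splitStep]
    have h2 : splitStep (before ++ (if pend then [Tok.A] else []), true, false, []) Tok.L =
        (before ++ (if pend then [Tok.A] else []), false, true, []) := by
      simp [splitStep]
    rw [h1, h2, foldl_splitStep_found, foldl_splitStep_found]
    simp [Term.redexDecomp]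
  | .app (.var i) N, h, before, pend, _ => by
    simp only [Term.hasRedex] at h
    simp only [Term.pre, List.cons_append, List.nil_append, List.foldl_cons]
    have h1 : splitStep (before, pend, false, []) Tok.A =
        (before ++ (if pend then [Tok.A] else []), true, false, []) := by
      cases pend <;> simp [splitStep]
    have h2 : splitStep (before ++ (if pend then [Tok.A] else []), true, false, []) (Tok.V i) =
        (before ++ (if pend then [Tok.A] else []) ++ [Tok.A, Tok.V i], false, false, []) := by
      simp [splitStep]
    rw [h1, h2, foldl_splitStep_redex N h _ false (fun h => by cases h)]
    simp [Term.redexDecomp]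
  | .app (.app M₁ M₂) N, h, before, pend, _ => by
    have h1 : splitStep (before, pend, false, []) Tok.A =
        (before ++ (if pend then [Tok.A] else []), true, false, []) := by
      cases pend <;> simp [splitStep]
    have hpre : Term.pre (.app (.app M₁ M₂) N) = Tok.A :: (Term.pre (.app M₁ M₂) ++ N.pre) := rfl
    rw [hpre, List.foldl_cons, List.foldl_append, h1]
    by_cases hM : Term.hasRedex (.app M₁ M₂) = true
    · rw [foldl_splitStep_redex (.app M₁ M₂) hM _ true (fun _ => rfl), foldl_splitStep_found,
        Term.redexDecomp, if_pos hM]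
      simp
    · have hN : N.hasRedex = true := by
        simp only [Term.hasRedex, Bool.or_eq_true] at h
        rcases h with h | h
        · exact absurd (by simpa [Term.hasRedex] using h) hM
        · exact h
      rw [foldl_splitStep_noRedex (.app M₁ M₂) (by simpa using hM) _ true (fun _ => rfl),
        foldl_splitStep_redex N hN _ false (fun h => by cases h), Term.redexDecomp, if_neg hM]
      simp
  | .app (.sum M₁ M₂) N, h, before, pend, _ => by
    have h1 : splitStep (before, pend, false, []) Tok.A =
        (before ++ (if pend then [Tok.A] else []), true, false, []) := by
      cases pend <;> simp [splitStep]
    have hpre : Term.pre (.app (.sum M₁ M₂) N) = Tok.A :: (Term.pre (.sum M₁ M₂) ++ N.pre) := rfl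
    rw [hpre, List.foldl_cons, List.foldl_append, h1]
    by_cases hM : Term.hasRedex (.sum M₁ M₂) = true
    · rw [foldl_splitStep_redex (.sum M₁ M₂) hM _ true (fun _ => rfl), foldl_splitStep_found,
        Term.redexDecomp, if_pos hM]
      simp
    · have hN : N.hasRedex = true := by
        simp only [Term.hasRedex, Bool.or_eq_true] at h
        rcases h with h | h
        · exact absurd (by simpa [Term.hasRedex] using h) hM
        · exact h
      rw [foldl_splitStep_noRedex (.sum M₁ M₂) (by simpa using hM) _ true (fun _ => rfl),
        foldl_splitStep_redex N hN _ false (fun h => by cases h), Term.redexDecomp, if_neg hM]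
      simp
  | .sum M N, h, before, pend, _ => by
    have h1 : splitStep (before, pend, false, []) Tok.S =
        (before ++ (if pend then [Tok.A] else []) ++ [Tok.S], false, false, []) := by
      cases pend <;> simp [splitStep]
    have hpre : Term.pre (.sum M N) = Tok.S :: (M.pre ++ N.pre) := rfl
    rw [hpre, List.foldl_cons, List.foldl_append, h1]
    by_cases hM : M.hasRedex = true
    · rw [foldl_splitStep_redex M hM _ false (fun h => by cases h), foldl_splitStep_found,
        Term.redexDecomp, if_pos hM]
      simp
    · have hN : N.hasRedex = true := by
        simp only [Term.hasRedex, Bool.or_eq_true] at h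
        rcases h with h | h
        · exact absurd h hM
        · exact h
      rw [foldl_splitStep_noRedex M (by simpa using hM) _ false (fun h => by cases h),
        foldl_splitStep_redex N hN _ false (fun h => by cases h), Term.redexDecomp, if_neg hM]
      simp

/-- **The leftmost-outermost step on codes is the leftmost-outermost step.**
[cite: GaboardiMarionRonchidellarocca2008, Thm. 3.5] -/
theorem loStepToks_pre (M : Term) : loStepToks M.pre = M.loStep.pre := by
  by_cases h : M.hasRedex = true
  · obtain ⟨h1, h2⟩ := M.redexDecomp_spec h
    have hs := foldl_splitStep_redex M h [] false (fun h => by cases h)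
    simp only [loStepToks, splitRedex]
    rw [hs]
    simp only [if_false, List.nil_append, Bool.false_eq_true, Bool.false_and, List.append_nil, if_true]
    rw [List.append_assoc M.redexDecomp.2.1.pre M.redexDecomp.2.2.1.pre M.redexDecomp.2.2.2,
      spanTerm_pre_append, spanTerm_pre_append, substToks_pre, h2]
  · have h' : M.hasRedex = false := by simpa using h
    have hs := foldl_splitStep_noRedex M h' [] false (fun h => by cases h)
    simp only [loStepToks, splitRedex]
    rw [hs, Term.loStep_of_hasRedex_false h']
    simp

/-- Iterating the step on codes. [folklore] -/
theorem loStepToks_iterate_pre (M : Term) (n : ℕ) : loStepToks^[n] M.pre = (Term.loStep^[n] M).pre := by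
  induction n with
  | zero => rfl
  | succ n ih => rw [Function.iterate_succ_apply', Function.iterate_succ_apply', ih, loStepToks_pre]

end STA

end Literature.Computability.ImplicitComplexity
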